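import Summits.MatrixMultiplication.OmegaCensus.SmallFormats.MatMul22nRankGF3Ladder2
import Summits.MatrixMultiplication.OmegaCensus.SmallFormats.MatMul229GF3Rank31
import Summits.MatrixMultiplication.OmegaCensus.SmallFormats.MatMul228GF3Rank28
import HarnessLib

/-!
# ω-census family (a): the `𝔽₃` small-format LADDER for `⟨2,2,n⟩`, `5 ≤ n ≤ 12`, as of 2026-08-29 23:45Z — `n = 9` now `[31, 32]`

Cell `pub-omega` (unit `pub-omega-tensor`, gen 41), topic `Summits/MatrixMultiplication/OmegaCensus` (sub-folder `SmallFormats`). Framing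
(verbatim): lottery ticket; floor = certified bounds/negative ranges. HONEST FRAMING: bookkeeping only — tensor g37's ladder
`tensorRank_matMulTensor_22n_gf3_ladder_5_12'` with the `n = 9` window `[30, 32]` replaced by `[31, 32]` (`Cover930.tensorRank_229_gf3_mem`, this
generation: the `(9,30)` funnel + cover certificate + tensor g40's two marginal exclusions), and the `n = 8` window restated with its exact
remaining obligation (`Cover827.tensorRank_228_gf3_eq_of_exclusion`: `= 28` as soon as the 15 kill-list marginals are excluded). No new mathematics;
nothing on `ω`.
-/

namespace Summit.MatrixMultiplication.OmegaCensus.SmallFormats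

open Literature.Computability.AlgebraicComplexity

/-- **The `𝔽₃` ladder for `⟨2,2,n⟩`, `5 ≤ n ≤ 12` (kernel, 2026-08-29 23:45Z).** Exact: `n = 5` (18), `n = 6` (21). Windows: `7` [24,25],
`8` [27,28], `9` [31,32], `10` [34,35], `11` [37,39], `12` [40,42]. -/
theorem tensorRank_matMulTensor_22n_gf3_ladder_5_12'' :
    tensorRank (matMulTensor (ZMod 3) 2 2 5) = 18 ∧
    tensorRank (matMulTensor (ZMod 3) 2 2 6) = 21 ∧
    tensorRank (matMulTensor (ZMod 3) 2 2 7) ∈ Set.Icc 24 25 ∧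
    tensorRank (matMulTensor (ZMod 3) 2 2 8) ∈ Set.Icc 27 28 ∧
    tensorRank (matMulTensor (ZMod 3) 2 2 9) ∈ Set.Icc 31 32 ∧
    tensorRank (matMulTensor (ZMod 3) 2 2 10) ∈ Set.Icc 34 35 ∧
    tensorRank (matMulTensor (ZMod 3) 2 2 11) ∈ Set.Icc 37 39 ∧
    tensorRank (matMulTensor (ZMod 3) 2 2 12) ∈ Set.Icc 40 42 := by
  obtain ⟨h5, h6, h7, h8, -, h10, h11, h12⟩ := tensorRank_matMulTensor_22n_gf3_ladder_5_12'
  exact ⟨h5, h6, h7, h8, Cover930.tensorRank_229_gf3_mem, h10, h11, h12⟩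

/-- The `n = 8` rung with its exact remaining obligation: `R_𝔽₃(⟨2,2,8⟩) ∈ [27, 28]` unconditionally, and `= 28` as soon as none of the 15
kill-list marginals `Cover827.REP827 j` (`j < 15`) is the X-marginal of a `27`-term computation. -/
theorem tensorRank_228_gf3_status :
    tensorRank (matMulTensor (ZMod 3) 2 2 8) ∈ Set.Icc 27 28 ∧
    ((∀ j, j < 15 → ∀ β : BilinComp (mulBilin (ZMod 3) 2 2 8) (Fin 27), RankOnePlaneCapGeneral.xMarginal β ≠ Cover827.REP827 j) →
      tensorRank (matMulTensor (ZMod 3) 2 2 8) = 28) :=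
  ⟨tensorRank_matMulTensor_22n_gf3_ladder_5_12''.2.2.2.1, Cover827.tensorRank_228_gf3_eq_of_exclusion⟩

end Summit.MatrixMultiplication.OmegaCensus.SmallFormats
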